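import Literature.AlgebraicGeometry.ShimuraVarieties.UnitaryBallSpecialCycleNonvacuity
import Literature.AlgebraicGeometry.ShimuraVarieties.UnitaryBallH1RestrictionToSpecialCurves
import Literature.AlgebraicGeometry.ShimuraVarieties.UnitaryBallHolomorphicLift
import Literature.AlgebraicGeometry.ShimuraVarieties.UnitaryBallConeChart
import HarnessLib

/-!
# Holomorphic 1-forms of a compact ball quotient read on the negative cone, and their transport along a
# compatible special curve ([MR92] §5, proof of Cor. C: «each `uᵢ` lies in some `T_x(Y_j(ℂ))`» — the chain rule)

Topic `AlgebraicGeometry/ShimuraVarieties`; namespace `Literature.AlgebraicGeometry.ShimuraVarieties.UnitaryBallUniformisationDatum`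
(datum-dotted). THEOREMS ONLY: no definition, no named fact, no instance, no `sorry`; imports = tree only.

Setting. `D : UnitaryBallUniformisationDatum p X` presents the smooth projective `X/ℂ` as `Γ \ 𝔹ᵖ` through the uniformisation
`unif : negCone H^{τ₁} → X(ℂ)` (★ `UnitaryBallQuotientDatum`); `A : HodgeModel p X` is a Hodge model of `X` (the complex manifold
`X^an` with its comparison `A.toComplexPoints : X^an ≃ X(ℂ)`, ★ `HodgeTheory/RationalHodgeClasses`). The tree reads the uniformisation
in `X^an` through a Sylvester chart of the BALL (`modelUnif`, `unifDeriv`, `formPullback₁`, `classLift` of ★ `UnitaryBallFormPullback` /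
★ `UnitaryBallHolomorphicLift`, all `p = 2`). This file reads it directly on the CONE `negCone H^{τ₁} ⊆ ℂ^{p+1}` — the map
`ψ = (X^an ≃ X(ℂ))⁻¹ ∘ unif : ℂ^{p+1} → X^an` (written out, no definition is introduced) — which is chart-free and therefore the
natural place to compare the uniformisations of a ball quotient SURFACE and of a compatible uniformised special CURVE
(★ III-8′ `IsCompatibleSpecialSource`: `φ(ℂ) ∘ unif₁ = unif ∘ M`).

* §1 (any `p`) `mdifferentiableAt_symm_comp_unif_of_mem_cone` — **`ψ` is holomorphic on the cone** as a map into `X^an`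
  (holomorphy into `X^an` is tested on regular functions, ★ `IsAnalytification.mdifferentiableAt_of_comp_regular`; the same statement
  is ★ `mdifferentiableAt_symm_comp_unif` of `UnitaryBallUniformisationLocalSection` — a private copy keeps this file's build
  independent), its real form `…_real`, `toComplexPoints_symm_comp_unif`, `symm_comp_unif_smul` (`ψ(c u) = ψ u`).
* §2 (any `p`) `mform_apply_mfderiv_symm_comp_unif_smul/_add` — for a `ℂ`-linear `1`-form `α` on `X^an`, the cone pull-back
  `t ↦ α_{ψ u}(dψ_u t)` is `ℂ`-LINEAR in `t` at every cone point (`dψ` is `ℂ`-linear, ★ `mfderiv_real_apply_smul`).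
* §3 (`p = 2` over `p = 1`) for a compatible special source `(Y, D₁, φ, M)` over a totally positive line `W` (★ `IsCompatibleSpecialSource`):
  `exists_eq_mulVec_of_forall_hermForm_eq_zero` — **the image of `M` is `W^⊥ ⊗ ℂ`** (`gram` makes `M` injective, `orthogonal` puts its
  image inside the kernel of `⟪τ₁ w₀, ·⟫`, both have dimension `2`); `mulVec_mem_negCone_iff` (`M v ∈ negCone H ↔ v ∈ negCone H₁`);
  `symm_comp_unif_mulVec` (`ψ (M v) = φ^an (ψ₁ v)`, ★ `HodgeModel.anMap`); and **the chain rule**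
  `mform_apply_mfderiv_mulVec_eq_pullback` — `α_{ψ(Mv)}(dψ_{Mv}(M t)) = ((φ^an)^* α)_{ψ₁ v}(dψ₁,ᵥ t)`: along the special sub-cone
  `M(negCone H₁) = negCone H ∩ (W^⊥ ⊗ ℂ)`, in the directions `W^⊥ ⊗ ℂ`, the cone pull-back of `α` IS the cone pull-back of `(φ^an)^* α`
  on the curve — [MR92]'s «`uᵢ` lies in `T_x(Y_j(ℂ))`» made quantitative.
* §4 (`p = 2`) the junction with the Sylvester chart: `t_mulVec_lift_coneChart` (`T·(z,1) = c · v` for `z = coneChart v`),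
  `unifDeriv_eq_mfderiv_comp` (`dψ^{ball}_z = dψ_{T(z,1)} ∘ d(z ↦ T(z,1))`), and `exists_rational_coneChart_mem` — the chart images of
  the `E`-rational cone vectors (very special points) meet every non-empty open subset of the ball ([MR92] Lemma A: a CM subfield is
  dense in `ℂ`; continuity and surjectivity of ★ `coneChart`).

These are the transport lemmas of a discharge of III-8′ `MR92Prop6Source` (sequel file); no statement about classes is made here.

## References
* [MurtyRamakrishnan1992] V. K. Murty, D. Ramakrishnan, *The Albanese of unitary Shimura varieties*, CRM Montréal (1992), §5,
  proof of Prop. 6, Lemma B and Cor. C (pp. 461–463).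
* [Liu2021] Y. Liu, Camb. J. Math. 9 (2021), proof of Thm. 4.15, l. 2207 («the morphism `Sh(G⋆,h⋆) → Sh(G,h)`») and l. 2212, fn. 9.
* [VoisinHodgeI2002] C. Voisin, *Hodge Theory and Complex Algebraic Geometry I*, §2.2.1 (holomorphic maps and real differentials),
  §7.3.2 (pull-back of forms along holomorphic maps).
* [SerreGAGA1956] J.-P. Serre, GAGA, §2 n°5–6 (functoriality of `X^h`, holomorphy tested on regular functions).
* [BergeronMillsonMoeglin2016Balls] N. Bergeron, J. Millson, C. Moeglin, Acta Math. 216 (2016), Part 2 §§1.1–1.3, 3.1–3.3.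
-/

set_option autoImplicit false

noncomputable section

open Matrix Function NumberField
open scoped Manifold Topology
open Literature.Geometry.ComplexHyperbolic
open Literature.Geometry.ComplexHyperbolic.BallModel (Ball)
open Literature.Geometry.Kaehler (MForm)
open Literature.NumberTheory.Transcendental
open Literature.AlgebraicGeometry.HodgeTheory (HodgeModel)

namespace Literature.AlgebraicGeometry.ShimuraVarieties

open Literature.AlgebraicGeometry.Motives (SchemeOver ComplexPoints AlgPoints)

namespace UnitaryBallUniformisationDatum

/-! ### §0 Plumbing: sesquilinearity of the complex form (private) -/

section Sesq

variable {m : Type*} [Fintype m] (Hc : Matrix m m ℂ)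

/-- `⟪u, v + v'⟫ = ⟪u, v⟫ + ⟪u, v'⟫`. [folklore] -/
private theorem hermForm_add_right (u v v' : m → ℂ) :
    hermForm (starRingEnd ℂ) Hc u (v + v') = hermForm (starRingEnd ℂ) Hc u v + hermForm (starRingEnd ℂ) Hc u v' := by
  rw [hermForm_starRingEnd, hermForm_starRingEnd, hermForm_starRingEnd, mulVec_add, dotProduct_add]

/-- `⟪u, c • v⟫ = c ⟪u, v⟫`. [folklore] -/
private theorem hermForm_smul_right (c : ℂ) (u v : m → ℂ) :
    hermForm (starRingEnd ℂ) Hc u (c • v) = c * hermForm (starRingEnd ℂ) Hc u v := by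
  rw [hermForm_starRingEnd, hermForm_starRingEnd, mulVec_smul, dotProduct_smul, smul_eq_mul]

/-- `⟪M u, M v⟫_{Hc} = ⟪u, v⟫_{Mᴴ Hc M}` (change of Gram matrix along a linear map). [folklore] -/
private theorem hermForm_mulVec_mulVec {n : Type*} [Fintype n] (M : Matrix m n ℂ) (u v : n → ℂ) :
    hermForm (starRingEnd ℂ) Hc (M *ᵥ u) (M *ᵥ v) = hermForm (starRingEnd ℂ) (Mᴴ * Hc * M) u v := by
  rw [hermForm_starRingEnd, hermForm_starRingEnd, star_mulVec, ← dotProduct_mulVec, mulVec_mulVec, mulVec_mulVec]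

end Sesq

section Density

/-- A CM subfield of `ℂ` is dense (it is not real; Mathlib `Complex.subfield_eq_of_closed`). [folklore] -/
private theorem dense_coe_subfield (E : Subfield ℂ) [NumberField E] [IsCMField E] : Dense (E : Set ℂ) := by
  have hnr : ¬ ComplexEmbedding.IsReal E.subtype := IsTotallyComplex.complexEmbedding_not_isReal _
  rw [ComplexEmbedding.isReal_iff] at hnr
  obtain ⟨x, hx⟩ : ∃ x : E, starRingEnd ℂ (x : ℂ) ≠ x := by
    by_contra h
    push Not at h
    exact hnr (RingHom.ext fun x ↦ by
      rw [ComplexEmbedding.conjugate_coe_eq]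
      exact h x)
  rcases Complex.subfield_eq_of_closed E.isClosed_topologicalClosure with h1 | h1
  · exfalso
    have hmem : (x : ℂ) ∈ E.topologicalClosure := E.le_topologicalClosure x.2
    rw [h1, RingHom.mem_fieldRange] at hmem
    obtain ⟨r, hr⟩ := hmem
    exact hx (by rw [← hr]; exact Complex.conj_ofReal r)
  · rw [dense_iff_closure_eq]
    have hc : ((E.topologicalClosure : Subfield ℂ) : Set ℂ) = closure (E : Set ℂ) := rfl
    rw [← hc, h1]
    rfl

/-- `E`-rational vectors meet every open set meeting the negative cone ([MR92] Lemma A; the public form is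
`RationalSubcone.exists_rational_mem_inter_negCone` of `UnitaryBallRationalSubconeDensity`). [folklore] -/
private theorem exists_rational_mem_inter_negCone (E : Subfield ℂ) [NumberField E] [IsCMField E] {n : ℕ}
    (Hc : Matrix (Fin n) (Fin n) ℂ) {O : Set (Fin n → ℂ)} (hO : IsOpen O) (hne : (O ∩ negCone Hc).Nonempty) :
    ∃ v₀ : Fin n → E, (fun i ↦ (v₀ i : ℂ)) ∈ O ∩ negCone Hc := by
  have hd : Dense (Set.pi Set.univ fun _ : Fin n ↦ (E : Set ℂ)) :=
    dense_pi Set.univ fun _ _ ↦ dense_coe_subfield E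
  obtain ⟨v, hv, hvO⟩ := hd.exists_mem_open (hO.inter (isOpen_negCone Hc)) hne
  exact ⟨fun i ↦ ⟨v i, hv i (Set.mem_univ i)⟩, hvO⟩

end Density

/-! ### §1 The uniformisation read in a Hodge model is holomorphic on the cone (any `p`) -/

section Cone

variable {p : ℕ} {X : SchemeOver ℂ} (D : UnitaryBallUniformisationDatum p X) (A : HodgeModel p X)

/-- `ψ = (X^an ≃ X(ℂ))⁻¹ ∘ unif` lies over `unif`: `A.toComplexPoints (ψ u) = unif u`. [cite: SerreGAGA1956, §2 n°5] -/
theorem toComplexPoints_symm_comp_unif (u : Fin (p + 1) → ℂ) :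
    A.toComplexPoints ((⇑A.isAnalytification.homeomorph.symm ∘ D.unif) u) = D.unif u :=
  A.isAnalytification.homeomorph.apply_symm_apply _

/-- `ψ` is constant on punctured complex lines of the cone: `ψ (c • u) = ψ u` (`c ≠ 0`).
[cite: BergeronMillsonMoeglin2016Balls, Part 2 §1.3] -/
theorem symm_comp_unif_smul {c : ℂ} (hc : c ≠ 0) {u : Fin (p + 1) → ℂ} (hu : u ∈ D.cone) :
    (⇑A.isAnalytification.homeomorph.symm ∘ D.unif) (c • u) = (⇑A.isAnalytification.homeomorph.symm ∘ D.unif) u := by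
  simp only [Function.comp_apply, D.unif_smul hc hu]

/-- `ψ` is continuous on the cone. [cite: BergeronMillsonMoeglin2016Balls, Introduction §1.1] -/
theorem continuousOn_symm_comp_unif :
    ContinuousOn (⇑A.isAnalytification.homeomorph.symm ∘ D.unif) D.cone :=
  A.isAnalytification.homeomorph.symm.continuous.comp_continuousOn D.continuousOn_unif

/-- **`ψ` is holomorphic on the cone, as a map into `X^an`** — a PRIVATE copy of ★
`UnitaryBallUniformisationDatum.mdifferentiableAt_symm_comp_unif` (`UnitaryBallUniformisationLocalSection`, any rank; kept local so
that this file elaborates independently of that module's build): regular functions pull back along `unif` to holomorphic functions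
on the cone (field `differentiableOn_unif`), and holomorphy into `X^an` is tested on regular functions
(★ `IsAnalytification.mdifferentiableAt_of_comp_regular`). [cite: SerreGAGA1956, §2 n°5 p. 9 and n°6 Prop. 3 Cor. 2] -/
private theorem mdifferentiableAt_symm_comp_unif' {u : Fin (p + 1) → ℂ} (hu : u ∈ D.cone) :
    MDifferentiableAt 𝓘(ℂ, Fin (p + 1) → ℂ) 𝓘(ℂ, A.model) (⇑A.isAnalytification.homeomorph.symm ∘ D.unif) u := by
  haveI := D.isSmoothProjective.smoothOfRelativeDimension
  refine A.isAnalytification.mdifferentiableAt_of_comp_regular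
    ((D.continuousOn_symm_comp_unif A).continuousAt ((isOpen_negCone _).mem_nhds hu)) ?_
  intro V hV hQ s
  have heq : (fun u' ↦ AlgPoints.evalOrZero V s (A.toComplexPoints ((⇑A.isAnalytification.homeomorph.symm ∘ D.unif) u'))) =
      fun u' ↦ AlgPoints.evalOrZero V s (D.unif u') :=
    funext fun u' ↦ by rw [toComplexPoints_symm_comp_unif]
  rw [heq, mdifferentiableAt_iff_differentiableAt]
  have hO : IsOpen (D.cone ∩ D.unif ⁻¹' {P | P.pt ∈ V}) :=
    D.continuousOn_unif.isOpen_inter_preimage (isOpen_negCone _) (AlgPoints.isOpen_setOf_pt_mem V)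
  have hmem : u ∈ D.cone ∩ D.unif ⁻¹' {P | P.pt ∈ V} :=
    ⟨hu, by
      change (D.unif u).pt ∈ V
      rw [← D.toComplexPoints_symm_comp_unif A u]
      exact hQ⟩
  exact (D.differentiableOn_unif ⟨V, hV⟩ s).differentiableAt (hO.mem_nhds hmem)

/-- **`ψ` is complex-differentiable at every cone point** (public restatement through the private copy; the tree's generic form is
★ `mdifferentiableAt_symm_comp_unif` of `UnitaryBallUniformisationLocalSection`). [cite: SerreGAGA1956, §2 n°6 Prop. 3 Cor. 2] -/
theorem mdifferentiableAt_symm_comp_unif_of_mem_cone {u : Fin (p + 1) → ℂ} (hu : u ∈ D.cone) :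
    MDifferentiableAt 𝓘(ℂ, Fin (p + 1) → ℂ) 𝓘(ℂ, A.model) (⇑A.isAnalytification.homeomorph.symm ∘ D.unif) u :=
  D.mdifferentiableAt_symm_comp_unif' A hu

/-- Real-differentiability of `ψ` at cone points (a holomorphic map is real-differentiable). [cite: VoisinHodgeI2002, §2.2.1] -/
theorem mdifferentiableAt_symm_comp_unif_real {u : Fin (p + 1) → ℂ} (hu : u ∈ D.cone) :
    MDifferentiableAt 𝓘(ℝ, Fin (p + 1) → ℂ) 𝓘(ℝ, A.model) (⇑A.isAnalytification.homeomorph.symm ∘ D.unif) u :=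
  (D.mdifferentiableAt_symm_comp_unif_of_mem_cone A hu).real_of_complex

/-! ### §2 The cone pull-back of a `ℂ`-linear `1`-form is `ℂ`-linear in the tangent vector -/

/-- **`dψ` is `ℂ`-linear**: `α_{ψ u}(dψ_u (c • t)) = c · α_{ψ u}(dψ_u t)` for a `ℂ`-linear `1`-form `α` on `X^an`
(`dψ_u` commutes with complex scalars since `ψ` is holomorphic at the cone point `u`). [cite: VoisinHodgeI2002, §2.2.1] -/
theorem mform_apply_mfderiv_symm_comp_unif_smul {α : MForm 𝓘(ℝ, A.model) A.carrier ℂ 1} (hα : IsComplexLinearForm α)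
    {u : Fin (p + 1) → ℂ} (hu : u ∈ D.cone) (c : ℂ) (t : Fin (p + 1) → ℂ) :
    α ((⇑A.isAnalytification.homeomorph.symm ∘ D.unif) u)
        (fun _ ↦ mfderiv 𝓘(ℝ, Fin (p + 1) → ℂ) 𝓘(ℝ, A.model) (⇑A.isAnalytification.homeomorph.symm ∘ D.unif) u (c • t)) =
      c * α ((⇑A.isAnalytification.homeomorph.symm ∘ D.unif) u)
        (fun _ ↦ mfderiv 𝓘(ℝ, Fin (p + 1) → ℂ) 𝓘(ℝ, A.model) (⇑A.isAnalytification.homeomorph.symm ∘ D.unif) u t) := by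
  rw [mfderiv_real_apply_smul (D.mdifferentiableAt_symm_comp_unif_of_mem_cone A hu), mform₁_apply_smul hα]

/-- Additivity in the tangent vector: `α_{ψ u}(dψ_u (t + t')) = α_{ψ u}(dψ_u t) + α_{ψ u}(dψ_u t')`. [cite: VoisinHodgeI2002, §2.2.1] -/
theorem mform_apply_mfderiv_symm_comp_unif_add (α : MForm 𝓘(ℝ, A.model) A.carrier ℂ 1)
    (u : Fin (p + 1) → ℂ) (t t' : Fin (p + 1) → ℂ) :
    α ((⇑A.isAnalytification.homeomorph.symm ∘ D.unif) u)
        (fun _ ↦ mfderiv 𝓘(ℝ, Fin (p + 1) → ℂ) 𝓘(ℝ, A.model) (⇑A.isAnalytification.homeomorph.symm ∘ D.unif) u (t + t')) =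
      α ((⇑A.isAnalytification.homeomorph.symm ∘ D.unif) u)
          (fun _ ↦ mfderiv 𝓘(ℝ, Fin (p + 1) → ℂ) 𝓘(ℝ, A.model) (⇑A.isAnalytification.homeomorph.symm ∘ D.unif) u t) +
        α ((⇑A.isAnalytification.homeomorph.symm ∘ D.unif) u)
          (fun _ ↦ mfderiv 𝓘(ℝ, Fin (p + 1) → ℂ) 𝓘(ℝ, A.model) (⇑A.isAnalytification.homeomorph.symm ∘ D.unif) u t') := by
  have h : (fun _ : Fin 1 ↦
        mfderiv 𝓘(ℝ, Fin (p + 1) → ℂ) 𝓘(ℝ, A.model) (⇑A.isAnalytification.homeomorph.symm ∘ D.unif) u (t + t')) =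
      fun _ ↦ mfderiv 𝓘(ℝ, Fin (p + 1) → ℂ) 𝓘(ℝ, A.model) (⇑A.isAnalytification.homeomorph.symm ∘ D.unif) u t +
        mfderiv 𝓘(ℝ, Fin (p + 1) → ℂ) 𝓘(ℝ, A.model) (⇑A.isAnalytification.homeomorph.symm ∘ D.unif) u t' := by
    funext
    exact map_add _ t t'
  rw [h]
  exact mform₁_apply_add α _ _ _

end Cone

/-! ### §3 Transport along a compatible uniformised special curve (`p = 2` over `p = 1`) -/

section Source

variable {X : SchemeOver ℂ} (D : UnitaryBallUniformisationDatum 2 X) {W : Submodule D.E (Fin 3 → D.E)}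
  {Y : SchemeOver ℂ} {D₁ : UnitaryBallUniformisationDatum 1 Y} {φ : Y ⟶ X} {M : Matrix (Fin 3) (Fin 2) ℂ}

/-- The complex Gram matrix of a uniformisation datum of ANY dimension is invertible (it has a Sylvester frame
`Tᴴ H T = diag(±1)`; the `p = 2` case is ★ `isUnit_Hℂ`). [cite: BergeronMillsonMoeglin2016Balls, Part 2 §1.1] -/
theorem isUnit_Hℂ_of_signature {q : ℕ} {Z : SchemeOver ℂ} (D' : UnitaryBallUniformisationDatum q Z) : IsUnit D'.Hℂ := by
  obtain ⟨T, hT⟩ := D'.signature_τ₁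
  have hdet : (D'.Hℂ).det ≠ 0 := by
    intro h0
    have h := congrArg Matrix.det hT
    rw [det_mul, det_mul, h0, mul_zero, zero_mul, signatureMatrix, det_diagonal] at h
    refine (Finset.prod_ne_zero_iff.2 fun i _ ↦ ?_) h.symm
    split_ifs <;> norm_num
  exact (Matrix.isUnit_iff_isUnit_det _).2 (isUnit_iff_ne_zero.2 hdet)

/-- **`gram` ⇒ `M` is injective**: `Mᴴ H^{τ₁} M = H₁^{τ₁}` with `H₁^{τ₁}` invertible. [cite: Liu2021, proof of Thm. 4.15, l. 2207] -/
theorem IsCompatibleSpecialSource.mulVec_injective (h : D.IsCompatibleSpecialSource W D₁ φ M) :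
    Function.Injective M.mulVec := by
  intro y y' hyy
  have h1 : D₁.Hℂ *ᵥ y = D₁.Hℂ *ᵥ y' := by
    change (D₁.H.map D₁.E.subtype) *ᵥ y = (D₁.H.map D₁.E.subtype) *ᵥ y'
    rw [← h.gram, ← mulVec_mulVec, ← mulVec_mulVec, ← mulVec_mulVec, ← mulVec_mulVec]
    change Mᴴ *ᵥ (D.Hℂ *ᵥ (M *ᵥ y)) = Mᴴ *ᵥ (D.Hℂ *ᵥ (M *ᵥ y'))
    rw [hyy]
  exact (mulVec_injective_iff_isUnit.2 D₁.isUnit_Hℂ_of_signature) h1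

/-- **`M v` is negative iff `v` is**: `⟪M v, M v⟫_{H} = ⟪v, v⟫_{H₁}` by `gram`. [cite: Liu2021, proof of Thm. 4.15, l. 2207] -/
theorem IsCompatibleSpecialSource.mulVec_mem_negCone_iff (h : D.IsCompatibleSpecialSource W D₁ φ M) (v : Fin 2 → ℂ) :
    M *ᵥ v ∈ D.cone ↔ v ∈ D₁.cone := by
  change (hermForm (starRingEnd ℂ) D.Hℂ (M *ᵥ v) (M *ᵥ v)).re < 0 ↔ (hermForm (starRingEnd ℂ) D₁.Hℂ v v).re < 0
  rw [hermForm_mulVec_mulVec]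
  change (hermForm (starRingEnd ℂ) (Mᴴ * D.H.map D.E.subtype * M) v v).re < 0 ↔ _
  rw [h.gram]

/-- **The image of `M` is `W^⊥ ⊗ ℂ`** for a totally positive definite LINE `W`: every complex vector orthogonal to `τ₁ W` is of the
form `M y`. (`orthogonal` puts the `2`-dimensional image of the injective `M` inside the kernel of the non-zero functional
`⟪τ₁ w₀, ·⟫`, `w₀` a generator of `W` — non-zero because `W` is positive at `τ₁` —, which has dimension `3 − 1 = 2`.)
[cite: Liu2021, proof of Thm. 4.15, l. 2207 («`V = V⋆ ⊕ V⋆^⊥`»)] [cite: BergeronMillsonMoeglin2016Balls, Part 2 §3.1] -/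
theorem IsCompatibleSpecialSource.exists_eq_mulVec_of_forall_hermForm_eq_zero (h : D.IsCompatibleSpecialSource W D₁ φ M)
    (hW : IsTotallyPositive (conjRingHom D.E) D.H W) (h1 : Module.finrank D.E W = 1) {x : Fin 3 → ℂ}
    (hx : ∀ w ∈ W, hermForm (starRingEnd ℂ) D.Hℂ (fun i ↦ (w i : ℂ)) x = 0) :
    ∃ y : Fin 2 → ℂ, x = M *ᵥ y := by
  -- a generator `w₀` of the line `W`
  obtain ⟨⟨w₀, hw₀W⟩, hw₀ne, -⟩ := finrank_eq_one_iff'.1 h1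
  have hw₀ : w₀ ≠ 0 := fun h0 ↦ hw₀ne (Subtype.ext h0)
  -- the functional `⟪τ₁ w₀, ·⟫`
  let ℓ : (Fin 3 → ℂ) →ₗ[ℂ] ℂ :=
    { toFun := fun x ↦ hermForm (starRingEnd ℂ) D.Hℂ (fun i ↦ (w₀ i : ℂ)) x
      map_add' := fun x x' ↦ hermForm_add_right _ _ _ _
      map_smul' := fun c x ↦ by rw [hermForm_smul_right, RingHom.id_apply, smul_eq_mul] }
  have hℓ_apply : ∀ x, ℓ x = hermForm (starRingEnd ℂ) D.Hℂ (fun i ↦ (w₀ i : ℂ)) x := fun _ ↦ rfl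
  -- it is non-zero at `τ₁ w₀` (total positivity), hence onto `ℂ`, with a kernel of dimension `2`
  have hpos : 0 < (ℓ fun i ↦ (w₀ i : ℂ)).re := by
    rw [hℓ_apply]
    have h := hW w₀ hw₀W hw₀ D.E.subtype
    rwa [map_hermForm D.E.subtype (embedding_conjRingHom D.E D.E.subtype)] at h
  have hℓ0 : ℓ (fun i ↦ (w₀ i : ℂ)) ≠ 0 := fun h0 ↦ by
    rw [h0, Complex.zero_re] at hpos
    exact lt_irrefl _ hpos
  have hrange : LinearMap.range ℓ = ⊤ := by
    refine eq_top_iff.2 fun z _ ↦ ⟨(z / ℓ fun i ↦ (w₀ i : ℂ)) • fun i ↦ (w₀ i : ℂ), ?_⟩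
    rw [map_smul, smul_eq_mul, div_mul_cancel₀ _ hℓ0]
  have hker : Module.finrank ℂ (LinearMap.ker ℓ) = 2 := by
    have hsum := ℓ.finrank_range_add_finrank_ker
    rw [hrange, finrank_top, Module.finrank_self, Module.finrank_fintype_fun_eq_card, Fintype.card_fin] at hsum
    omega
  -- the image of `M` lies in the kernel and has dimension `2`
  have hle : LinearMap.range (Matrix.mulVecLin M) ≤ LinearMap.ker ℓ := by
    rintro _ ⟨y, rfl⟩
    rw [LinearMap.mem_ker, hℓ_apply, Matrix.mulVecLin_apply]
    exact h.orthogonal w₀ hw₀W y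
  have hrk : Module.finrank ℂ (LinearMap.range (Matrix.mulVecLin M)) = 2 := by
    rw [LinearMap.finrank_range_of_inj (h.mulVec_injective D), Module.finrank_fintype_fun_eq_card, Fintype.card_fin]
  have heq : LinearMap.range (Matrix.mulVecLin M) = LinearMap.ker ℓ :=
    Submodule.eq_of_le_of_finrank_eq hle (by rw [hrk, hker])
  -- conclusion
  have hxker : x ∈ LinearMap.ker ℓ := by
    rw [LinearMap.mem_ker, hℓ_apply]
    exact hx w₀ hw₀W
  rw [← heq] at hxker
  obtain ⟨y, hy⟩ := hxker
  exact ⟨y, by rw [← hy, Matrix.mulVecLin_apply]⟩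

variable (A : HodgeModel 2 X) (A₁ : HodgeModel 1 Y)

/-- **The two uniformisations under `unif_comp`**: `ψ (M v) = φ^an (ψ₁ v)` for `v` in the cone of the curve, where
`φ^an : Y^an → X^an` is the analytified morphism (★ `HodgeModel.anMap`) — both sides lie over `unif (M v) = φ(ℂ)(unif₁ v)`.
[cite: Liu2021, proof of Thm. 4.15, l. 2207] [cite: SerreGAGA1956, §2 n°5 (fonctorialité de X^h)] -/
theorem IsCompatibleSpecialSource.symm_comp_unif_mulVec (h : D.IsCompatibleSpecialSource W D₁ φ M)
    {v : Fin 2 → ℂ} (hv : v ∈ D₁.cone) :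
    (⇑A.isAnalytification.homeomorph.symm ∘ D.unif) (M *ᵥ v) =
      HodgeModel.anMap A A₁ φ ((⇑A₁.isAnalytification.homeomorph.symm ∘ D₁.unif) v) := by
  apply A.isAnalytification.homeomorph.injective
  change A.toComplexPoints _ = A.toComplexPoints _
  rw [toComplexPoints_symm_comp_unif, HodgeModel.toComplexPoints_anMap, toComplexPoints_symm_comp_unif]
  exact (h.unif_comp v hv).symm

/-- **The chain rule along a compatible special curve** ([MR92] p. 462: the tangent vectors `uᵢ` of the sub-varieties `Y_j` through a
very special point): for `v` in the cone of the curve and any `t ∈ ℂ²`,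
`α_{ψ(Mv)}(dψ_{Mv}(M t)) = ((φ^an)^* α)_{ψ₁ v}(dψ₁,ᵥ t)` — the cone pull-back of a `1`-form `α` of `X^an`, at the points of the special
sub-cone `M(negCone H₁)` and in its tangent directions `M ℂ² = W^⊥ ⊗ ℂ`, is the cone pull-back on the CURVE of the pulled-back form
`(φ^an)^* α` (`ψ ∘ M = φ^an ∘ ψ₁` near `v`, `φ^an` holomorphic by GAGA, chain rule for `mfderiv`).
[cite: MurtyRamakrishnan1992, §5 Lemma B and Cor. C (p. 462)] [cite: VoisinHodgeI2002, §2.2.1 and §7.3.2] -/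
theorem IsCompatibleSpecialSource.mform_apply_mfderiv_mulVec_eq_pullback (h : D.IsCompatibleSpecialSource W D₁ φ M)
    (α : MForm 𝓘(ℝ, A.model) A.carrier ℂ 1) {v : Fin 2 → ℂ} (hv : v ∈ D₁.cone) (t : Fin 2 → ℂ) :
    α ((⇑A.isAnalytification.homeomorph.symm ∘ D.unif) (M *ᵥ v))
        (fun _ ↦ mfderiv 𝓘(ℝ, Fin 3 → ℂ) 𝓘(ℝ, A.model) (⇑A.isAnalytification.homeomorph.symm ∘ D.unif) (M *ᵥ v) (M *ᵥ t)) =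
      (α.pullback 𝓘(ℝ, A₁.model) (HodgeModel.anMap A A₁ φ)) ((⇑A₁.isAnalytification.homeomorph.symm ∘ D₁.unif) v)
        (fun _ ↦ mfderiv 𝓘(ℝ, Fin 2 → ℂ) 𝓘(ℝ, A₁.model) (⇑A₁.isAnalytification.homeomorph.symm ∘ D₁.unif) v t) := by
  -- notation-free abbreviations
  set ψ : (Fin 3 → ℂ) → A.carrier := ⇑A.isAnalytification.homeomorph.symm ∘ D.unif with hψ
  set ψ₁ : (Fin 2 → ℂ) → A₁.carrier := ⇑A₁.isAnalytification.homeomorph.symm ∘ D₁.unif with hψ₁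
  set fan : A₁.carrier → A.carrier := HodgeModel.anMap A A₁ φ with hfan
  have hMv : M *ᵥ v ∈ D.cone := (h.mulVec_mem_negCone_iff D v).2 hv
  -- the linear map `M` and its derivative
  let Mℝ : (Fin 2 → ℂ) →L[ℝ] (Fin 3 → ℂ) := (LinearMap.toContinuousLinearMap (Matrix.mulVecLin M)).restrictScalars ℝ
  have hMderiv : HasMFDerivAt 𝓘(ℝ, Fin 2 → ℂ) 𝓘(ℝ, Fin 3 → ℂ) (fun y : Fin 2 → ℂ ↦ M *ᵥ y) v Mℝ :=
    hasMFDerivAt_iff_hasFDerivAt.2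
      (((LinearMap.toContinuousLinearMap (Matrix.mulVecLin M)).hasFDerivAt).restrictScalars ℝ)
  -- the two composites agree near `v`
  have hEq : (ψ ∘ fun y : Fin 2 → ℂ ↦ M *ᵥ y) =ᶠ[𝓝 v] (fan ∘ ψ₁) := by
    filter_upwards [(isOpen_negCone _).mem_nhds hv] with y hy
    exact h.symm_comp_unif_mulVec D A A₁ hy
  -- chain rules
  have hψd : HasMFDerivAt 𝓘(ℝ, Fin 3 → ℂ) 𝓘(ℝ, A.model) ψ (M *ᵥ v)
      (mfderiv 𝓘(ℝ, Fin 3 → ℂ) 𝓘(ℝ, A.model) ψ (M *ᵥ v)) :=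
    (D.mdifferentiableAt_symm_comp_unif_real A hMv).hasMFDerivAt
  have hcomp₁ := (hψd.comp v hMderiv).mfderiv
  have hψ₁d : MDifferentiableAt 𝓘(ℝ, Fin 2 → ℂ) 𝓘(ℝ, A₁.model) ψ₁ v := D₁.mdifferentiableAt_symm_comp_unif_real A₁ hv
  have hfand : MDifferentiableAt 𝓘(ℝ, A₁.model) 𝓘(ℝ, A.model) fan (ψ₁ v) :=
    ((HodgeModel.mdifferentiable_anMap A A₁ φ D₁.isSmoothProjective D.isSmoothProjective) _).real_of_complex
  have hcomp₂ : mfderiv 𝓘(ℝ, Fin 2 → ℂ) 𝓘(ℝ, A.model) (fan ∘ ψ₁) v =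
      (mfderiv 𝓘(ℝ, A₁.model) 𝓘(ℝ, A.model) fan (ψ₁ v)).comp (mfderiv 𝓘(ℝ, Fin 2 → ℂ) 𝓘(ℝ, A₁.model) ψ₁ v) :=
    mfderiv_comp v hfand hψ₁d
  have hderiv : mfderiv 𝓘(ℝ, Fin 3 → ℂ) 𝓘(ℝ, A.model) ψ (M *ᵥ v) (Mℝ t) =
      mfderiv 𝓘(ℝ, A₁.model) 𝓘(ℝ, A.model) fan (ψ₁ v) (mfderiv 𝓘(ℝ, Fin 2 → ℂ) 𝓘(ℝ, A₁.model) ψ₁ v t) := by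
    have h1 : mfderiv 𝓘(ℝ, Fin 2 → ℂ) 𝓘(ℝ, A.model) (ψ ∘ fun y : Fin 2 → ℂ ↦ M *ᵥ y) v t =
        mfderiv 𝓘(ℝ, Fin 3 → ℂ) 𝓘(ℝ, A.model) ψ (M *ᵥ v) (Mℝ t) := by
      rw [hcomp₁]
      rfl
    rw [← h1, hEq.mfderiv_eq, hcomp₂]
    rfl
  -- evaluate the pulled-back form
  have hpt : ψ (M *ᵥ v) = fan (ψ₁ v) := h.symm_comp_unif_mulVec D A A₁ hv
  have hMt : (M *ᵥ t : Fin 3 → ℂ) = Mℝ t := rfl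
  rw [MForm.pullback_apply]
  change α (ψ (M *ᵥ v)) (fun _ ↦ mfderiv 𝓘(ℝ, Fin 3 → ℂ) 𝓘(ℝ, A.model) ψ (M *ᵥ v) (Mℝ t)) =
    α (fan (ψ₁ v)) (fun _ ↦ mfderiv 𝓘(ℝ, A₁.model) 𝓘(ℝ, A.model) fan (ψ₁ v)
      (mfderiv 𝓘(ℝ, Fin 2 → ℂ) 𝓘(ℝ, A₁.model) ψ₁ v t))
  rw [hderiv]
  exact congrArg (fun x ↦ α x (fun _ ↦ mfderiv 𝓘(ℝ, A₁.model) 𝓘(ℝ, A.model) fan (ψ₁ v)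
    (mfderiv 𝓘(ℝ, Fin 2 → ℂ) 𝓘(ℝ, A₁.model) ψ₁ v t))) hpt

end Source

/-! ### §4 Junction with the Sylvester chart of the ball (`p = 2`) -/

section Chart

variable {X : SchemeOver ℂ} (D : UnitaryBallUniformisationDatum 2 X) (A : HodgeModel 2 X) (𝔣 : D.SylvesterFrame)

/-- The chart section over a cone vector is on its complex line: `T · (z₀, z₁, 1) = ((T⁻¹ v)₂)⁻¹ · v` for `z = coneChart v`.
[cite: BergeronMillsonMoeglin2016Balls, Part 2 §1.3] -/
theorem t_mulVec_lift_coneChart (v : D.cone) :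
    𝔣.t *ᵥ ![(D.coneChart 𝔣 v).1 0, (D.coneChart 𝔣 v).1 1, 1] = ((𝔣.ti *ᵥ (v : Fin 3 → ℂ)) 2)⁻¹ • (v : Fin 3 → ℂ) := by
  have hl : (![(D.coneChart 𝔣 v).1 0, (D.coneChart 𝔣 v).1 1, 1] : Fin 3 → ℂ) = BallModel.lift (D.coneChart 𝔣 v) := rfl
  rw [hl, coneChart, lift_proj, mulVec_smul, mulVec_mulVec, 𝔣.t_mul_ti, one_mulVec]

/-- The uniformisation in the chart IS `ψ` composed with the chart section: `modelUnif z = ψ (T (z₀, z₁, 1))` (definitional).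
[cite: BergeronMillsonMoeglin2016Balls, Introduction §1.1] -/
theorem modelUnif_eq_symm_comp_unif (w : Fin 2 → ℂ) :
    D.modelUnif A 𝔣 w = (⇑A.isAnalytification.homeomorph.symm ∘ D.unif) (𝔣.t *ᵥ ![w 0, w 1, 1]) :=
  rfl

/-- **`dψ^{ball}_z = dψ_{T(z,1)} ∘ d(w ↦ T(w,1))_z`**: the differential of the chart uniformisation (★ `unifDeriv`) factors through the
cone differential (chain rule; the chart section is complex-differentiable, ★ `differentiable_frameLift`). [cite: VoisinHodgeI2002, §2.2.1] -/
theorem unifDeriv_apply_eq_mfderiv_comp (z : Ball) (t : Fin 2 → ℂ) :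
    D.unifDeriv A 𝔣 z.1 t =
      mfderiv 𝓘(ℝ, Fin 3 → ℂ) 𝓘(ℝ, A.model) (⇑A.isAnalytification.homeomorph.symm ∘ D.unif) (𝔣.t *ᵥ ![z.1 0, z.1 1, 1])
        (mfderiv 𝓘(ℝ, Fin 2 → ℂ) 𝓘(ℝ, Fin 3 → ℂ) (fun w : Fin 2 → ℂ ↦ 𝔣.t *ᵥ ![w 0, w 1, 1]) z.1 t) := by
  have hc : 𝔣.t *ᵥ ![z.1 0, z.1 1, 1] ∈ D.cone := (D.coneLift 𝔣 z).2
  have hψd : HasMFDerivAt 𝓘(ℝ, Fin 3 → ℂ) 𝓘(ℝ, A.model) (⇑A.isAnalytification.homeomorph.symm ∘ D.unif)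
      (𝔣.t *ᵥ ![z.1 0, z.1 1, 1])
      (mfderiv 𝓘(ℝ, Fin 3 → ℂ) 𝓘(ℝ, A.model) (⇑A.isAnalytification.homeomorph.symm ∘ D.unif) (𝔣.t *ᵥ ![z.1 0, z.1 1, 1])) :=
    (D.mdifferentiableAt_symm_comp_unif_real A hc).hasMFDerivAt
  have hfl : HasMFDerivAt 𝓘(ℝ, Fin 2 → ℂ) 𝓘(ℝ, Fin 3 → ℂ) (fun w : Fin 2 → ℂ ↦ 𝔣.t *ᵥ ![w 0, w 1, 1]) z.1
      (mfderiv 𝓘(ℝ, Fin 2 → ℂ) 𝓘(ℝ, Fin 3 → ℂ) (fun w : Fin 2 → ℂ ↦ 𝔣.t *ᵥ ![w 0, w 1, 1]) z.1) :=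
    ((D.differentiable_frameLift 𝔣 z.1).mdifferentiableAt.real_of_complex).hasMFDerivAt
  have h := (hψd.comp z.1 hfl).mfderiv
  change mfderiv 𝓘(ℝ, Fin 2 → ℂ) 𝓘(ℝ, A.model)
    ((⇑A.isAnalytification.homeomorph.symm ∘ D.unif) ∘ fun w : Fin 2 → ℂ ↦ 𝔣.t *ᵥ ![w 0, w 1, 1]) z.1 t = _
  rw [h]
  rfl

/-- **Very special points are dense in the ball chart** ([MR92] §5 Lemma A, read through ★ `coneChart`): every non-empty open subset
of `𝔹²` contains the chart of an `E`-RATIONAL cone vector (the chart is continuous and onto, and `E³ ∩ negCone` is dense in the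
cone — [MR92] Lemma A). [cite: MurtyRamakrishnan1992, §5 Lemma A (p. 461)] -/
theorem exists_rational_coneChart_mem {O : Set Ball} (hO : IsOpen O) (hne : O.Nonempty) :
    ∃ (v₀ : Fin 3 → D.E) (hv₀ : (fun i ↦ (v₀ i : ℂ)) ∈ D.cone), D.coneChart 𝔣 ⟨fun i ↦ (v₀ i : ℂ), hv₀⟩ ∈ O := by
  obtain ⟨z, hz⟩ := hne
  -- the preimage of `O` in the cone is open in the subtype topology and contains `coneLift z`
  have hpre : IsOpen (D.coneChart 𝔣 ⁻¹' O) := hO.preimage (D.continuous_coneChart 𝔣)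
  obtain ⟨O', hO', hO'eq⟩ := isOpen_induced_iff.1 hpre
  have hmem : D.coneLift 𝔣 z ∈ D.coneChart 𝔣 ⁻¹' O := by
    rw [Set.mem_preimage, D.coneChart_coneLift 𝔣 z]
    exact hz
  have hmem' : ((D.coneLift 𝔣 z : D.cone) : Fin 3 → ℂ) ∈ O' ∩ negCone D.Hℂ := by
    refine ⟨?_, (D.coneLift 𝔣 z).2⟩
    rw [← hO'eq] at hmem
    exact hmem
  obtain ⟨v₀, hv₀O', hv₀c⟩ := exists_rational_mem_inter_negCone D.E D.Hℂ hO' ⟨_, hmem'⟩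
  refine ⟨v₀, hv₀c, ?_⟩
  have : (⟨fun i ↦ (v₀ i : ℂ), hv₀c⟩ : D.cone) ∈ D.coneChart 𝔣 ⁻¹' O := by
    rw [← hO'eq]
    exact hv₀O'
  exact this

end Chart

end UnitaryBallUniformisationDatum

end Literature.AlgebraicGeometry.ShimuraVarieties

end
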